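import Summits.BirchSwinnertonDyer.BirchSwinnertonDyer.Theorems.CountingDoorF2AtThreeSelmerAverageFloor
import Literature.NumberTheory.EllipticCurves.BhargavaHo2022.MinimalMembers
import Literature.NumberTheory.EllipticCurves.BhargavaHo2022.SelmerTwoAverage

/-!
# Counting door (F₂, p = 3): the crux I1 over MINIMAL members of F₂ (one representative per isomorphism class)

Route `CountingDoorF2AtThree`, crux I1 `SelmerThreeAverageLargeF2` (item stmt-BirchSwinnertonDyer-19440): support (hygiene of
the typing), `--supports` only; nothing here proves I1.

The averages in I1 run over PARAMETER tuples `a = (a₁, a₂, a₂', a₃)` of height `< X`, so a `ℚ`-isomorphism class of curves with two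
marked points is met once for each of its integral scalings `(u a₁, u² a₂, u² a₂', u³ a₃)` below the height bound. Bhargava–Ho
address this (§1, after Thm. 1.1): every class has a unique representative of minimal height, "a curve is minimal in `F` exactly when,
for every prime `p`, it is not the case that `pⁱ ∣ aᵢ` … for all `i`", the averages "do not change even when one averages only over
these minimal curves", and "the sets of all minimal curves in … `F₂` are large". The Literature file
`BhargavaHo2022/MinimalMembers.lean` types the minimal members as the congruence subfamily `CongruenceFamily₂.minimal` and PROVES it
large (`isLarge_minimal`, from `p¹² ∣ Δ` under `p ∣ a₁, p² ∣ a₂, p² ∣ a₂', p³ ∣ a₃`) with nonempty residue sets. Hence, BY NAME: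

* `selmerThreeAverage_minimal_of_selmerThreeAverageLargeF2` — I1 ⇒ `limsup` of the average of `#Sel₃` over the MINIMAL members of
  height `< X` is `≤ 36` (the "ordered by minimal height" form of the crux);
* `selmerTwoAverage_minimal_of_thm1_2` — the same for Bhargava–Ho's own Thm. 1.1(g)/1.2 (`#Sel₂`, bound `12`), modulo the named fact
  `thm1_2_F2_selmerTwo` (this is the printed "resp. minimal height" clause, obtained here from the large-family clause);
* `selmerThreeAverage_window_minimal` — modulo `LargeFamilyInputsF2` (BH Thm. 9.1/10.1), I1 pins the minimal-member averages into
  `[9 − ε, 36 + ε]` eventually (floor lemma `selmerThreeAverage_window` of `…SelmerAverageFloor`, residues of `minimal` nonempty);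
* `not_averageOnLE_selmerThree_minimal_of_lt_nine` — no constant `< 9` can replace `36` on the minimal family either.

PARTITION: none — r_an ≥ 2, summit axis S0; B1: nothing here reads an analytic rank; I1 / BSD are NOT proved by this file.
References: [BhargavaHo2022] §1 (minimal elements; Thm. 1.1(g), 1.2; "minimal curves … are large"), Thm. 9.1, Thm. 10.1.
-/

namespace Summit.BirchSwinnertonDyer.BirchSwinnertonDyer.Theorems

open Filter
open Literature.NumberTheory.EllipticCurves.BhargavaHo2022
open Summit.BirchSwinnertonDyer.BirchSwinnertonDyer.Theses.CountingDoorF2AtThree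

/-- **I1 over minimal members.** `SelmerThreeAverageLargeF2` ⇒ the `limsup` of the average of `#Sel₃(E_a)` over the MINIMAL members
of `F₂` of height `< X` is at most `36` — each isomorphism class of `F₂`-curves counted through its minimal-height representatives
("ordered by minimal height"). [cite: BhargavaHo2022, §1 (minimal elements; "the sets of all minimal curves in … F₂ are large")] -/
theorem selmerThreeAverage_minimal_of_selmerThreeAverageLargeF2 (h1 : SelmerThreeAverageLargeF2) :
    CongruenceFamily₂.minimal.AverageOnLE (fun a ↦ (Nat.card (a.curve.selmerGroup 3) : ℝ)) 36 :=
  h1 _ CongruenceFamily₂.isLarge_minimal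

/-- **Bhargava–Ho Thm. 1.1(g) "resp. minimal height", by name**: modulo the named fact `thm1_2_F2_selmerTwo` (average of `#Sel₂`
at most `12` over every large subfamily of `F₂`), the average of `#Sel₂` over the minimal members is at most `12`.
[cite: BhargavaHo2022, Thm. 1.1(g), Thm. 1.2 and §1 ("averages … do not change even when one averages only over these minimal curves")] -/
theorem selmerTwoAverage_minimal_of_thm1_2 (h : thm1_2_F2_selmerTwo) :
    CongruenceFamily₂.minimal.AverageOnLE (fun a ↦ (Nat.card (a.curve.selmerGroup 2) : ℝ)) 12 :=
  h _ CongruenceFamily₂.isLarge_minimal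

/-- **The window for I1 on minimal members**: modulo `LargeFamilyInputsF2` (BH Thm. 9.1/10.1), I1 gives, for every `ε > 0`,
eventually `9 − ε ≤ avg_{minimal, H < X} #Sel₃ ≤ 36 + ε`. [cite: BhargavaHo2022, §1 (minimal curves are large), Thm. 9.1, Thm. 10.1] -/
theorem selmerThreeAverage_window_minimal (hL : LargeFamilyInputsF2) (h1 : SelmerThreeAverageLargeF2) {ε : ℝ} (hε : 0 < ε) :
    ∀ᶠ X : ℕ in atTop, 9 - ε ≤ CongruenceFamily₂.minimal.averageOn (fun a ↦ (Nat.card (a.curve.selmerGroup 3) : ℝ)) X ∧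
      CongruenceFamily₂.minimal.averageOn (fun a ↦ (Nat.card (a.curve.selmerGroup 3) : ℝ)) X ≤ 36 + ε :=
  selmerThreeAverage_window hL h1 _ CongruenceFamily₂.isLarge_minimal CongruenceFamily₂.residues_minimal_nonempty hε

/-- **No constant below `9` on the minimal family** (modulo `LargeFamilyInputsF2`): for `c < 9`,
`minimal.AverageOnLE #Sel₃ c` is false. [cite: BhargavaHo2022, Thm. 9.1, Thm. 10.1, §1 (minimal curves are large)] -/
theorem not_averageOnLE_selmerThree_minimal_of_lt_nine (hL : LargeFamilyInputsF2) {c : ℝ} (hc : c < 9) :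
    ¬ CongruenceFamily₂.minimal.AverageOnLE (fun a ↦ (Nat.card (a.curve.selmerGroup 3) : ℝ)) c :=
  not_averageOnLE_selmerThree_of_lt_nine hL _ CongruenceFamily₂.isLarge_minimal
    CongruenceFamily₂.residues_minimal_nonempty hc

end Summit.BirchSwinnertonDyer.BirchSwinnertonDyer.Theorems
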